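import Summits.AtomisticToContinuum.HydrodynamicLimit.Theses.CollisionIsometryCLT

/-!
# Vocabulary of the line `contact-source-duhamel` for the crux `AdaptedWeightCLT`
(stmt-AtomisticToContinuum-12949; rank 2 of route `CollisionIsometryCLT`, sub-problem `HydrodynamicLimit`)

Definitions-only support file (`--supports stmt-AtomisticToContinuum-12949`) of the lead prover of the
line (`Cruxes/AdaptedWeightCLT/Lines/contact-source-duhamel.lean`, planner
`planner-cruxplan-stmt-AtomisticToContinuum-12949-contact-source-duhamel`, skeleton registered on the
item with the seven stubs `stub_duhamel`, `stub_flowDictionary`, `stub_columnDepolarisation`,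
`stub_pastDamping`, `stub_contactCrossNull`, `stub_sourceContraction`, `stub_reduction`). It makes the
line's vocabulary IMPORTABLE so that each registered stub can land in its own sorry-free Theorems file
with the registered signature verbatim: the types `T3, V3, Cfg, Vel, Flow, Flows, Mat3, Tens`; the
crux's fold step by step (`pre, stepMap, transferSteps, steps, stepPair, stepNormal, iprF, velAfter` —
verbatim the bodies of the crux's `let M; let ipr`); rank-`r` tensors and projections (`tpow, mapT,
pairT, normSqT, projM, coprojM, projV, coprojV, crossT`); the incoherent transport, contact sources and
their chaos values (`tStep, tTransport, src, chaosCross, srcCh`); the window functionals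
(`blkF, pastF, xiF, xiChF`), the column-depolarisation functionals (`baseV, dirV, iso2, cloud, cd2,
cd3`), the tests `C2, C3`, the line window (`Δℓ, winLen, winStart`), the flow-side block functionals
(`wgt, ubar, PastSq, blkFlow, DefectSq, XiDevSq, XiCorr`). The statements of the line (`NiceProfiles`,
`AdmissibleKernel`, `DuhamelIdentity`, `FlowDictionary`, `DiffuseAt`, `TailsAt`, `CruxTail`, `CDAlongAt`,
`PastSmallAt`, `CrossNullAt`, `SourceContractionAt`) and the `Iff.rfl` bridge to the crux live in the
companion file `CollisionIsometryCLTAdaptedWeightCLTStatements.lean` (400-line cap). All bodies are copied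
byte-for-byte from the registered skeleton; nothing is asserted here (no `def … : Prop` at all in this
file: only objects).

The mathematics (idea card `contact-source-duhamel`, triage r1 pass ×3): along a hard-sphere path the
one-particle tensors `(v_i − u)^{⊗r}` obey an exact inhomogeneous linear recursion at every collision,
`(Qy_i + Py_j)^{⊗r} = Q^{⊗r}y_i^{⊗r} + P^{⊗r}y_j^{⊗r} + crossT_r(Qy_i, Py_j)`; iterated along the fold
(variation of constants) the block moment is the incoherent transport of the window-start tensors (PAST)
plus the window sum of transported contact sources (Ξ), compared with its chaos value Ξ^ch.
-/

namespace Summit.AtomisticToContinuum.HydrodynamicLimit.Theorems.ContactSourceDuhamel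

open scoped BigOperators Topology Classical MeasureTheory ENNReal InnerProductSpace
open Filter Set MeasureTheory

noncomputable section

/-! ## Types -/

/-- The macroscopic torus `𝕋³`. -/
abbrev T3 : Type := UnitAddTorus (Fin 3)
/-- Velocity space `ℝ³`. -/
abbrev V3 : Type := EuclideanSpace ℝ (Fin 3)
/-- Phase space of `N + 1` spheres on `𝕋³` (the crux's configuration type). -/
abbrev Cfg (N : ℕ) : Type := Literature.Analysis.FluidPDE.Config (N + 1) (Fin 3) T3
/-- Velocity fields of `N + 1` spheres. -/
abbrev Vel (N : ℕ) : Type := Fin (N + 1) → V3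
/-- A hard-sphere flow of `N + 1` spheres of diameter `hsDiameter σ N` on `𝕋³`. -/
abbrev Flow (σ : ℝ) (N : ℕ) : Type :=
  Literature.Analysis.FluidPDE.HardSphereFlow (Literature.Analysis.FluidPDE.Torus.geometry (Fin 3))
    (Literature.MathematicalPhysics.KineticTheory.hsDiameter σ N) (N + 1)
/-- Families of hard-sphere flows at reduced density `σ` (the crux's `Φ`). -/
abbrev Flows (σ : ℝ) : Type := (N : ℕ) → Flow σ N
/-- `3 × 3` real matrices as functions (entries of the projections `P`, `Q`). -/
abbrev Mat3 : Type := Fin 3 → Fin 3 → ℝ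
/-- Rank-`r` tensors on `ℝ³` as functions of a multi-index `Fin r → Fin 3` (`r = 2`: the stress
channel, `r = 3`: the heat-flux channel; one set of definitions serves both). -/
abbrev Tens (r : ℕ) : Type := (Fin r → Fin 3) → ℝ

/-! ## The crux's fold, step by step (verbatim `let`s of the crux; same names as the sibling line
`DiffuseBackwardInfluence/Lines/kinship-lyapunov.lean`) -/

/-- The pre-collisional configuration ending the `k`-th free flight of the Alexander construction
started at `y` (the crux's `pre k`, verbatim). -/
def pre (σ : ℝ) (N : ℕ) (y : Cfg N) (k : ℕ) : Cfg N :=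
  Literature.Analysis.FluidPDE.freeFlight (Literature.Analysis.FluidPDE.Torus.geometry (Fin 3))
    (Literature.Analysis.FluidPDE.Alexander.freeExitTime
      (Literature.Analysis.FluidPDE.Torus.geometry (Fin 3))
      (Literature.MathematicalPhysics.KineticTheory.hsDiameter σ N)
      (Literature.Analysis.FluidPDE.Alexander.stateAfter
        (Literature.Analysis.FluidPDE.Torus.geometry (Fin 3))
        (Literature.MathematicalPhysics.KineticTheory.hsDiameter σ N) y k)).toReal
    (Literature.Analysis.FluidPDE.Alexander.stateAfter
      (Literature.Analysis.FluidPDE.Torus.geometry (Fin 3))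
      (Literature.MathematicalPhysics.KineticTheory.hsDiameter σ N) y k)

/-- One fold step of the crux's transfer: the velocity part of `collidePair` at the realised incoming
pair of `pre k` (the identity if there is none), applied to a velocity field `W` placed at the positions
of `pre k` (verbatim the crux's `fun W' k => dite …`). -/
def stepMap (σ : ℝ) (N : ℕ) (y : Cfg N) (k : ℕ) (W : Vel N) : Vel N :=
  @dite (Fin (N + 1) → EuclideanSpace ℝ (Fin 3))
    (Literature.Analysis.FluidPDE.Alexander.incomingPairs
      (Literature.Analysis.FluidPDE.Torus.geometry (Fin 3))
      (Literature.MathematicalPhysics.KineticTheory.hsDiameter σ N) (pre σ N y k)).Nonempty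
    (Classical.propDecidable _)
    (fun h => fun i => (Literature.Analysis.FluidPDE.collidePair
      (Literature.Analysis.FluidPDE.Torus.geometry (Fin 3)) h.some.1 h.some.2
      (fun j => ((pre σ N y k j).1, W j)) i).2)
    (fun _ => W)

/-- The transfer after the first `m` fold steps; the crux's `M N y Δ W` is
`transferSteps σ N y (steps σ N y Δ) W`. -/
def transferSteps (σ : ℝ) (N : ℕ) (y : Cfg N) (m : ℕ) (W : Vel N) : Vel N :=
  (List.range m).foldl (fun W' k => stepMap σ N y k W') W

/-- The number of fold steps whose collision instant lies in the closed window `[0, s]` (the crux's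
`collisionCount`). -/
def steps (σ : ℝ) (N : ℕ) (y : Cfg N) (s : ℝ) : ℕ :=
  Literature.Analysis.FluidPDE.Alexander.collisionCount
    (Literature.Analysis.FluidPDE.Torus.geometry (Fin 3))
    (Literature.MathematicalPhysics.KineticTheory.hsDiameter σ N) y s

/-- The incoming pair `(i, j)`, `i < j`, reflected at fold step `k` (`none` if the step is the identity). -/
def stepPair (σ : ℝ) (N : ℕ) (y : Cfg N) (k : ℕ) : Option (Fin (N + 1) × Fin (N + 1)) :=
  @dite (Option (Fin (N + 1) × Fin (N + 1)))
    (Literature.Analysis.FluidPDE.Alexander.incomingPairs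
      (Literature.Analysis.FluidPDE.Torus.geometry (Fin 3))
      (Literature.MathematicalPhysics.KineticTheory.hsDiameter σ N) (pre σ N y k)).Nonempty
    (Classical.propDecidable _)
    (fun h => some h.some) (fun _ => none)

/-- The (unnormalised) collision normal of fold step `k`: the separation vector `sepVec xᵢ xⱼ` of the
reflected pair in `pre k` — the direction `collidePair`/`reflectVel` use; `0` if there is no pair. -/
def stepNormal (σ : ℝ) (N : ℕ) (y : Cfg N) (k : ℕ) : V3 :=
  match stepPair σ N y k with
  | none => 0
  | some ij => (Literature.Analysis.FluidPDE.Torus.geometry (Fin 3)).sepVec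
      (pre σ N y k ij.1).1 (pre σ N y k ij.2).1

/-- The crux's mean inverse participation ratio `ipr N y Δ` with its `let M` written as
`transferSteps … (steps …)` (so that H1 is `DiffuseAt` definitionally). -/
def iprF (σ : ℝ) (N : ℕ) (y : Cfg N) (Δ : ℝ) : ℝ :=
  ((N + 1 : ℕ) : ℝ)⁻¹ * ∑ i : Fin (N + 1), ∑ k : Fin (N + 1),
    (∑ a : Fin 3, ‖transferSteps σ N y (steps σ N y Δ)
      (Pi.single k (EuclideanSpace.single a (1 : ℝ))) i‖ ^ 2) ^ 2

/-- The velocities after `m` fold steps: the transfer applied to the velocities of `y` itself (on good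
data these are the actual pre-collisional velocities of step `m`, `stub_flowDictionary`). -/
def velAfter (σ : ℝ) (N : ℕ) (y : Cfg N) (m : ℕ) : Vel N :=
  transferSteps σ N y m (fun i => (y i).2)

/-! ## Tensors -/

/-- The rank-`r` power `y^{⊗r}` of a vector. -/
def tpow (r : ℕ) (y : V3) : Tens r := fun idx => ∏ s : Fin r, y (idx s)

/-- The action `P^{⊗r}` of a matrix on all slots of a rank-`r` tensor. -/
def mapT {r : ℕ} (P : Mat3) (T : Tens r) : Tens r :=
  fun idx => ∑ idx' : Fin r → Fin 3, (∏ s : Fin r, P (idx s) (idx' s)) * T idx'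

/-- The Euclidean pairing of two rank-`r` tensors. -/
def pairT {r : ℕ} (C T : Tens r) : ℝ := ∑ idx : Fin r → Fin 3, C idx * T idx

/-- The squared Frobenius norm of a rank-`r` tensor. -/
def normSqT {r : ℕ} (T : Tens r) : ℝ := ∑ idx : Fin r → Fin 3, T idx ^ 2

/-- The matrix of the normal projection `P = n nᵀ/|n|²` (`0` at `n = 0`). -/
def projM (n : V3) : Mat3 := fun a b => n a * n b / ‖n‖ ^ 2
/-- The matrix of the tangential projection `Q = 𝟙 − P` (`𝟙` at `n = 0`). -/
def coprojM (n : V3) : Mat3 := fun a b => (if a = b then 1 else 0) - n a * n b / ‖n‖ ^ 2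
/-- `P y = (⟪n, y⟫/|n|²) n` — the normal component (as in `reflectVel`; `0` at `n = 0`). -/
def projV (n y : V3) : V3 := (inner ℝ n y / ‖n‖ ^ 2) • n
/-- `Q y = y − P y` — the tangential component. -/
def coprojV (n y : V3) : V3 := y - projV n y

/-- The CROSS TERMS of the binomial expansion of `(Qa + Pb)^{⊗r}`: the sum over the non-trivial subsets
`S` of slots of the tensor with `Pb` in the slots of `S` and `Qa` elsewhere, so that
`(Qa + Pb)^{⊗r} = (Qa)^{⊗r} + (Pb)^{⊗r} + crossT r (Qa) (Pb)` (rank 2: `Qa ⊗ Pb + Pb ⊗ Qa`; rank 3: the six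
mixed terms). This is the contact SOURCE of the line. -/
def crossT (r : ℕ) (qa pb : V3) : Tens r :=
  fun idx => ∑ S ∈ (Finset.univ : Finset (Finset (Fin r))).filter (fun S => S ≠ ∅ ∧ S ≠ Finset.univ),
    ∏ s : Fin r, (if s ∈ S then pb (idx s) else qa (idx s))

/-! ## Incoherent transport, sources, chaos values -/

/-- One step of the INCOHERENT (decoupled-power) transport `𝒯` of a family of rank-`r` tensors along
the fold: at a step reflecting `(i, j)` with normal `n`, `Tᵢ ↦ Q^{⊗r}Tᵢ + P^{⊗r}Tⱼ`,
`Tⱼ ↦ Q^{⊗r}Tⱼ + P^{⊗r}Tᵢ`, all other particles unchanged; the identity at an identity step. Linear,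
positivity-preserving on rank-2 families, trace-preserving (`tr(QTQ + PTP) = tr T`). -/
def tStep (r : ℕ) (σ : ℝ) (N : ℕ) (y : Cfg N) (k : ℕ) (T : Fin (N + 1) → Tens r) :
    Fin (N + 1) → Tens r :=
  match stepPair σ N y k with
  | none => T
  | some ij =>
    Function.update (Function.update T ij.1
        (mapT (coprojM (stepNormal σ N y k)) (T ij.1) + mapT (projM (stepNormal σ N y k)) (T ij.2)))
      ij.2 (mapT (coprojM (stepNormal σ N y k)) (T ij.2) + mapT (projM (stepNormal σ N y k)) (T ij.1))

/-- The incoherent transport through the fold steps `m₁, m₁ + 1, …, m₁ + n − 1`. -/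
def tTransport (r : ℕ) (σ : ℝ) (N : ℕ) (y : Cfg N) (m₁ n : ℕ) (T : Fin (N + 1) → Tens r) :
    Fin (N + 1) → Tens r :=
  (List.range' m₁ n).foldl (fun T' k => tStep r σ N y k T') T

/-- The contact SOURCE family of fold step `l` (shift `u`): at the reflected pair `(i, j)` with normal
`n` and pre-collisional shifted velocities `yᵢ = velAfter l i − u`, `yⱼ = velAfter l j − u`, particle `i`
carries `crossT r (Q yᵢ) (P yⱼ)` and particle `j` carries `crossT r (Q yⱼ) (P yᵢ)`; zero elsewhere and
at identity steps. -/
def src (r : ℕ) (σ : ℝ) (N : ℕ) (y : Cfg N) (u : V3) (l : ℕ) : Fin (N + 1) → Tens r :=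
  match stepPair σ N y l with
  | none => 0
  | some ij =>
    Function.update (Function.update 0 ij.1
        (crossT r (coprojV (stepNormal σ N y l) (velAfter σ N y l ij.1 - u))
          (projV (stepNormal σ N y l) (velAfter σ N y l ij.2 - u))))
      ij.2 (crossT r (coprojV (stepNormal σ N y l) (velAfter σ N y l ij.2 - u))
          (projV (stepNormal σ N y l) (velAfter σ N y l ij.1 - u)))

/-- The CHAOS VALUE of a contact source given the realised normal `n`: the average of
`crossT r (Q ỹ) (P ỹ')` over an independent pair `(ỹ, ỹ')` drawn from the product of the weighted
empirical (shifted) velocity law `Σ_k w_k δ_{W_k − u}` with the hard-sphere FLUX weight `|⟪W_k − W_k', n⟫|`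
(the unnormalised normal only rescales numerator and denominator alike; `0/0 = 0`). -/
def chaosCross (r : ℕ) (N : ℕ) (w : Fin (N + 1) → ℝ) (W : Vel N) (u n : V3) : Tens r :=
  fun idx =>
    (∑ k : Fin (N + 1), ∑ k' : Fin (N + 1),
        w k * w k' * |inner ℝ (W k - W k') n| *
          crossT r (coprojV n (W k - u)) (projV n (W k' - u)) idx) /
      (∑ k : Fin (N + 1), ∑ k' : Fin (N + 1), w k * w k' * |inner ℝ (W k - W k') n|)

/-- The chaos-value source family of fold step `l`: the tensor `chaosCross` of the block law
(weights `w`, velocities `velAfter l`, shift `u`, realised normal) placed at both reflected particles. -/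
def srcCh (r : ℕ) (σ : ℝ) (N : ℕ) (y : Cfg N) (w : Fin (N + 1) → ℝ) (u : V3) (l : ℕ) :
    Fin (N + 1) → Tens r :=
  match stepPair σ N y l with
  | none => 0
  | some ij =>
    Function.update (Function.update 0 ij.1
        (chaosCross r N w (velAfter σ N y l) u (stepNormal σ N y l)))
      ij.2 (chaosCross r N w (velAfter σ N y l) u (stepNormal σ N y l))

/-! ## Window functionals of the line (window start `y`, `m` fold steps, weights `w`, shift `u`) -/

/-- The block moment of rank `r` after `m` fold steps, read off the FOLD velocities:
`(N+1)⁻¹ Σ_i w_i ⟨C, (velAfter m i − u)^{⊗r}⟩` (the left-hand side of the Duhamel identity paired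
with the weights; equals `pastF + xiF`). -/
def blkF (r : ℕ) (σ : ℝ) (N : ℕ) (y : Cfg N) (m : ℕ) (w : Fin (N + 1) → ℝ) (u : V3) (C : Tens r) : ℝ :=
  ((N + 1 : ℕ) : ℝ)⁻¹ * ∑ i : Fin (N + 1), w i * pairT C (tpow r (velAfter σ N y m i - u))

/-- PAST: the transported window-start tensors paired with the weighted test,
`(N+1)⁻¹ Σ_i w_i ⟨C, (𝒯_{0→m} ((y_k).2 − u)^{⊗r})_i⟩`. -/
def pastF (r : ℕ) (σ : ℝ) (N : ℕ) (y : Cfg N) (m : ℕ) (w : Fin (N + 1) → ℝ) (u : V3) (C : Tens r) : ℝ :=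
  ((N + 1 : ℕ) : ℝ)⁻¹ * ∑ i : Fin (N + 1),
    w i * pairT C (tTransport r σ N y 0 m (fun k => tpow r ((y k).2 - u)) i)

/-- Ξ: the window sum of transported contact sources paired with the weighted test,
`(N+1)⁻¹ Σ_{l<m} Σ_i w_i ⟨C, (𝒯_{l+1→m} src_l)_i⟩`. -/
def xiF (r : ℕ) (σ : ℝ) (N : ℕ) (y : Cfg N) (m : ℕ) (w : Fin (N + 1) → ℝ) (u : V3) (C : Tens r) : ℝ :=
  ((N + 1 : ℕ) : ℝ)⁻¹ * ∑ l ∈ Finset.range m, ∑ i : Fin (N + 1),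
    w i * pairT C (tTransport r σ N y (l + 1) (m - (l + 1)) (src r σ N y u l) i)

/-- Ξ^ch: the same window sum with every source replaced by its chaos value `srcCh`. -/
def xiChF (r : ℕ) (σ : ℝ) (N : ℕ) (y : Cfg N) (m : ℕ) (w : Fin (N + 1) → ℝ) (u : V3) (C : Tens r) : ℝ :=
  ((N + 1 : ℕ) : ℝ)⁻¹ * ∑ l ∈ Finset.range m, ∑ i : Fin (N + 1),
    w i * pairT C (tTransport r σ N y (l + 1) (m - (l + 1)) (srcCh r σ N y w u l) i)

/-! ## Column depolarisation functionals (rank 2: distance of the impulse cloud's stress to `|a|²𝟙/3`;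
rank 3: norm of the cloud's cubic tensor), over the six directions `(e_p + e_q)/‖e_p + e_q‖` -/

/-- The coordinate vector `e_p`. -/
def baseV (p : Fin 3) : V3 := EuclideanSpace.single p (1 : ℝ)
/-- The six probe directions `(e_p + e_q)/‖e_p + e_q‖` (`e_p` for `p = q`): their rank-one squares span
the symmetric matrices, so depolarisation along them controls every injected impulse tensor. -/
def dirV (p q : Fin 3) : V3 := (‖baseV p + baseV q‖)⁻¹ • (baseV p + baseV q)
/-- The depolarised rank-2 value `|a|² 𝟙/3` of an impulse `a`. -/
def iso2 (a : V3) : Tens 2 := fun idx => if idx 0 = idx 1 then ‖a‖ ^ 2 / 3 else 0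

/-- The impulse CLOUD tensor: inject `a^{⊗r}` at particle `k`, transport it incoherently through the
first `m` fold steps, and sum over all carriers (rank 2: the impulse-gas stress `J_k(a)`, trace `|a|²`). -/
def cloud (r : ℕ) (σ : ℝ) (N : ℕ) (y : Cfg N) (m : ℕ) (k : Fin (N + 1)) (a : V3) : Tens r :=
  ∑ i : Fin (N + 1), tTransport r σ N y 0 m (Pi.single k (tpow r a)) i

/-- Rank-2 COLUMN DEPOLARISATION functional over the window `[0, Δ]`: the mean over injection sites and
probe directions of `‖cloud − |a|²𝟙/3‖²` (bounded by `2/3 · 9`). -/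
def cd2 (σ : ℝ) (N : ℕ) (y : Cfg N) (Δ : ℝ) : ℝ :=
  ((N + 1 : ℕ) : ℝ)⁻¹ * ∑ k : Fin (N + 1), ∑ p : Fin 3, ∑ q : Fin 3,
    normSqT (cloud 2 σ N y (steps σ N y Δ) k (dirV p q) - iso2 (dirV p q))

/-- Rank-3 column depolarisation functional: the mean over injection sites and probe directions of the
squared norm of the cubic cloud tensor (spin-1 suppression target; bounded by `9`). -/
def cd3 (σ : ℝ) (N : ℕ) (y : Cfg N) (Δ : ℝ) : ℝ :=
  ((N + 1 : ℕ) : ℝ)⁻¹ * ∑ k : Fin (N + 1), ∑ p : Fin 3, ∑ q : Fin 3,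
    normSqT (cloud 3 σ N y (steps σ N y Δ) k (dirV p q))

/-! ## Tests, line window, flow-side functionals -/

/-- The traceless rank-2 tests `E_{jk} − δ_{jk} 𝟙/3`: paired with `Σ_i w_i y_i ⊗ y_i /(N+1)` they return
the crux's `D … j k` exactly. -/
def C2 (j k : Fin 3) : Tens 2 :=
  fun idx => (if idx 0 = j ∧ idx 1 = k then 1 else 0) - (if j = k ∧ idx 0 = idx 1 then 1 / 3 else 0)
/-- The rank-3 tests `½ δ_{a·} δ_{··}`: `⟨C3 a, y^{⊗3}⟩ = ½ y_a |y|²`, so they return the components of the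
crux's heat flux `q`. -/
def C3 (a : Fin 3) : Tens 3 :=
  fun idx => if idx 0 = a ∧ idx 1 = idx 2 then 1 / 2 else 0

/-- The LINE WINDOW `Δℓ_N = (N+1)^{-1/3} log(N+2)`: admissible (`→ 0`, `Δℓ_N (N+1)^{1/3} → ∞`) and short
enough for the initial layer and the kernel-gradient errors (`N^{4γ} Δℓ_N → 0` for `γ ≤ 1/15`). -/
def Δℓ (N : ℕ) : ℝ := (((N : ℝ) + 1) ^ (-(1 : ℝ) / 3)) * Real.log ((N : ℝ) + 2)
/-- The window length used at time `s`: `Δℓ_N` for `s ≥ Δℓ_N`, and `0` in the initial layer `s < Δℓ_N`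
(no negative times are ever used). -/
def winLen (N : ℕ) (s : ℝ) : ℝ := if s < Δℓ N then 0 else Δℓ N

/-- The window-start configuration `Φ_{s − winLen} z`. -/
def winStart (σ : ℝ) (N : ℕ) (Φ : Flow σ N) (s : ℝ) (z : Cfg N) : Cfg N := Φ.flow (s - winLen N s) z

/-- The block weights at `(s, x)`: `w_i = φ_N(x_i(s) − x)` (positions at the FINAL time `s`). -/
def wgt (σ : ℝ) (N : ℕ) (Φ : Flow σ N) (φ : ℕ → T3 → ℝ) (s : ℝ) (z : Cfg N) (x : T3) : Fin (N + 1) → ℝ :=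
  fun i => φ N ((Φ.flow s z i).1 - x)

/-- The block velocity `ū = m̄/ρ̄` at `(s, x)` (verbatim the crux's `ub`). -/
def ubar (σ : ℝ) (N : ℕ) (Φ : Flow σ N) (φ : ℕ → T3 → ℝ) (s : ℝ) (z : Cfg N) (x : T3) : V3 :=
  (Literature.MathematicalPhysics.KineticTheory.empiricalDensityField (Φ.flow s z) (fun y => φ N (y - x)))⁻¹ •
    Literature.MathematicalPhysics.KineticTheory.empiricalMomentumField (Φ.flow s z) (fun y => φ N (y - x))

/-- `Σ_tests PAST²` at `(s, x)` (both channels), the fold restarted at `winStart` with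
`m = steps (winLen N s)` steps, weights `wgt`, shift `ubar`. -/
def PastSq (σ : ℝ) (N : ℕ) (Φ : Flow σ N) (φ : ℕ → T3 → ℝ) (s : ℝ) (z : Cfg N) (x : T3) : ℝ :=
  (∑ j : Fin 3, ∑ k : Fin 3,
      pastF 2 σ N (winStart σ N Φ s z) (steps σ N (winStart σ N Φ s z) (winLen N s)) (wgt σ N Φ φ s z x)
        (ubar σ N Φ φ s z x) (C2 j k) ^ 2) +
    ∑ a : Fin 3,
      pastF 3 σ N (winStart σ N Φ s z) (steps σ N (winStart σ N Φ s z) (winLen N s)) (wgt σ N Φ φ s z x)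
        (ubar σ N Φ φ s z x) (C3 a) ^ 2

/-! ## Flow-side block functionals -/

/-- The block moment of rank `r` at `(s, x)` read off the FLOW velocities:
`(N+1)⁻¹ Σ_i φ_N(x_i(s) − x) ⟨C, (v_i(s) − ū(s,x))^{⊗r}⟩`; for `C = C2 j k` this is the crux's
`D N s z x j k`, for `C = C3 a` the `a`-component of the crux's `q N s z x` (finite-sum form of the
empirical integrals; `stub_reduction`). -/
def blkFlow (r : ℕ) (σ : ℝ) (N : ℕ) (Φ : Flow σ N) (φ : ℕ → T3 → ℝ) (s : ℝ) (z : Cfg N) (x : T3)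
    (C : Tens r) : ℝ :=
  ((N + 1 : ℕ) : ℝ)⁻¹ * ∑ i : Fin (N + 1),
    wgt σ N Φ φ s z x i * pairT C (tpow r ((Φ.flow s z i).2 - ubar σ N Φ φ s z x))

/-- `|D|² + |q|²` at `(s, x)` in tensor form: `Σ_{jk} blkFlow(C2 j k)² + Σ_a blkFlow(C3 a)²`. -/
def DefectSq (σ : ℝ) (N : ℕ) (Φ : Flow σ N) (φ : ℕ → T3 → ℝ) (s : ℝ) (z : Cfg N) (x : T3) : ℝ :=
  (∑ j : Fin 3, ∑ k : Fin 3, blkFlow 2 σ N Φ φ s z x (C2 j k) ^ 2) +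
    ∑ a : Fin 3, blkFlow 3 σ N Φ φ s z x (C3 a) ^ 2

/-- `Σ_tests (Ξ − Ξ^ch)²` at `(s, x)`: the CHAOS DEFECT of the window source sums (both channels). -/
def XiDevSq (σ : ℝ) (N : ℕ) (Φ : Flow σ N) (φ : ℕ → T3 → ℝ) (s : ℝ) (z : Cfg N) (x : T3) : ℝ :=
  (∑ j : Fin 3, ∑ k : Fin 3,
      (xiF 2 σ N (winStart σ N Φ s z) (steps σ N (winStart σ N Φ s z) (winLen N s)) (wgt σ N Φ φ s z x)
          (ubar σ N Φ φ s z x) (C2 j k) -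
        xiChF 2 σ N (winStart σ N Φ s z) (steps σ N (winStart σ N Φ s z) (winLen N s))
          (wgt σ N Φ φ s z x) (ubar σ N Φ φ s z x) (C2 j k)) ^ 2) +
    ∑ a : Fin 3,
      (xiF 3 σ N (winStart σ N Φ s z) (steps σ N (winStart σ N Φ s z) (winLen N s)) (wgt σ N Φ φ s z x)
          (ubar σ N Φ φ s z x) (C3 a) -
        xiChF 3 σ N (winStart σ N Φ s z) (steps σ N (winStart σ N Φ s z) (winLen N s))
          (wgt σ N Φ φ s z x) (ubar σ N Φ φ s z x) (C3 a)) ^ 2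

/-- `Σ_tests Blk · Ξ^ch` at `(s, x)`: the CORRELATION of the chaos value of the window source sums
with the current visible block moments (`Σ_{jk} D_jk Ξ^ch_{jk} + Σ_a q_a Ξ^ch_a` after the
dictionary). The line's closure statement bounds it above by `κ (|D|² + |q|²)`, `κ < 1`; the
mechanism predicts it NEGATIVE (restoring force). -/
def XiCorr (σ : ℝ) (N : ℕ) (Φ : Flow σ N) (φ : ℕ → T3 → ℝ) (s : ℝ) (z : Cfg N) (x : T3) : ℝ :=
  (∑ j : Fin 3, ∑ k : Fin 3,
      blkFlow 2 σ N Φ φ s z x (C2 j k) *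
        xiChF 2 σ N (winStart σ N Φ s z) (steps σ N (winStart σ N Φ s z) (winLen N s))
          (wgt σ N Φ φ s z x) (ubar σ N Φ φ s z x) (C2 j k)) +
    ∑ a : Fin 3,
      blkFlow 3 σ N Φ φ s z x (C3 a) *
        xiChF 3 σ N (winStart σ N Φ s z) (steps σ N (winStart σ N Φ s z) (winLen N s))
          (wgt σ N Φ φ s z x) (ubar σ N Φ φ s z x) (C3 a)

/-! ## Registered anchors of the vocabulary (sub-goals `velAfter_zero`, `transferSteps_succ` of the crux item) -/

/-- Before any fold step the fold velocities are the configuration's own velocities. -/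
theorem velAfter_zero : ∀ (σ : ℝ) (N : ℕ) (y : Cfg N), velAfter σ N y 0 = fun i => (y i).2 :=
  fun _ _ _ => rfl

/-- One more fold step: `M(m+1) W = stepMap m (M(m) W)` (`List.range_succ`, `List.foldl_append`). -/
theorem transferSteps_succ : ∀ (σ : ℝ) (N : ℕ) (y : Cfg N) (m : ℕ) (W : Vel N),
    transferSteps σ N y (m + 1) W = stepMap σ N y m (transferSteps σ N y m W) := by
  intro σ N y m W
  simp only [transferSteps, List.range_succ, List.foldl_append, List.foldl_cons, List.foldl_nil]

end

end Summit.AtomisticToContinuum.HydrodynamicLimit.Theorems.ContactSourceDuhamel
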